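import Literature.MathematicalPhysics.QuantumFieldTheory.Balaban1983to89.B9Eq326ConjugatedDeltaA
import Literature.MathematicalPhysics.QuantumFieldTheory.Balaban1983to89.B9Eq3126ConjugatedQG1QLetters

/-!
# `Balaban1983to89.B9Eq3126ConjugatedQG1QInv` — T. Bałaban, *Propagators for lattice gauge theories in a background field*, Commun. Math. Phys. **99** (1985)
# 389–434 [Balaban1985BackgroundPropagators] (3.26) p. 395, (3.49) p. 399, (3.126) p. 420, Thm 3.11 p. 416 with T. Bałaban, *The variational problem and
# background fields in renormalization group method for lattice gauge theories*, Commun. Math. Phys. **102** (1985) 277–309 [Balaban1985Variational] (45) p. 285,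
# (103) p. 293, (110) p. 294: **THE CONJUGATED INVERSE GRAM OPERATOR `(QG₁(U)Q*)⁻¹` IS BOUNDED ON THE COMBES–THOMAS CIRCLE — `‖S_F (QG₁Q*)⁻¹ S_F⁻¹‖ ≤ 2∕μ₁`** —
# the INSTANCE of `B9Eq3126ConjugatedQG1QLetters.norm_c1k_le` (abstract, over `B9Eq326ConjugatedDeltaAResolvent` ∕ `…Letters`) at the chain's
# `Δ_a(U) = Δ(U) + D_UR(U)D*_U + Q†(a•Q)` (`B9Eq326OperatorAssembly.laplaceAofU`), `G₁(U) = Δ_a(U)⁻¹` (`G1ofU`) and `(QG₁Q*)⁻¹` (`B11Eq103H1Complex.KinvLatticeK`,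
# the tree's (45) object with `QG₁Q*(QG₁Q*)⁻¹ = 1` PROVED, `hK_lattice`), exactly as `B9Eq326ConjugatedDeltaA.norm_conjG1ofU_le` instantiates `norm_Gk_le_projected`:
# the curl ∕ cocurl ∕ divergence ∕ gradient conjugation letters DISCHARGED by `B9Eq3101ConjugationLettersCurl` ∕ `…CoCurl` ∕ `…Chain`, the `R(U)` projection facts
# and the two-sided inverse identities PROVED, and DISPLAYED: the `γ`-coercivity of `Δ_a` and the lower bound `μ₁‖g‖² ≤ re⟪g, QG₁Q†g⟫` (Thm 3.11 ∕ [B11] (45)),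
# the `Δ′` letters `p_K`, `β_K`, the bound `‖Qf‖ ≤ C_Q‖f‖`, the conjugation pair `S_F`, `S_F⁻¹` on the block space `F` with the `Q(U)` seams
# `‖S_FQS⁻¹ − Q‖ ≤ β`, `‖SQ†S_F⁻¹ − Q†‖ ≤ β`, the conjugated-projection letter `ρ ≤ 1∕8`, the complementary-projection letter `C_P`, and the two windows
# `small` (of `B9Eq326ConjugatedDeltaALetters`) and `small2 : s₁ ≤ μ₁∕2` (of `B9Eq3126ConjugatedQG1QLetters`) — the Combes–Thomas INPUT for the `L²` block
# decay of the fourth primitive row `(QG₁Q*)⁻¹` of [B9] (3.126) ∕ Lemma 3.10 (`H₁ = G₁Q*(QG₁Q*)⁻¹`)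

statement-level skeleton of published theorems with citation tags; proofs where landed; nothing here is a claim about the Yang–Mills mass gap

CITATION HEADER (lean-in-tree rule).  Audit cell `pub-balaban`, sub-cell `t4`, BINDER row NE9 (road ΔA-CT of the NE9 formalisation swarm, leaf prover 03
`b2b-balaban-t4-ne9-formalise-leaf-03` gen 75).  Sources READ first-hand: [Balaban1985BackgroundPropagators] p. 395 (3.26), p. 399 (3.49) (print asserts the decay
of `G₁`, `H₁`, `(QG₁Q*)⁻¹`'s kernels with SOME `δ₀` — NOT asserted here), p. 416 Thm 3.11 («uniformly bounded … positive» — DISPLAYED as `hpos`, `hcoer`, `hX1`),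
p. 420 (3.126); [Balaban1985Variational] p. 285 (45), p. 293 (103), p. 294 (110).  The Combes–Thomas device is [folklore]; print's own route to (3.49) for
`(QG₁Q*)⁻¹` is Lemma 3.10's random-walk expansion, NOT followed here.

WHAT IS PROVED (sorry-free; proof lane — no `def`).
* `X1_factorisation` — `S(Q†(a•Q(S⁻¹f))) = a•(SQ†S_F⁻¹)((S_FQS⁻¹)f)` (insert `S_F⁻¹S_F = 1`);
* `conjKinv_rightInverse` — `(S_FQS⁻¹)(SG₁S⁻¹)(SQ†S_F⁻¹)(S_F(QG₁Q*)⁻¹S_F⁻¹)v = v` (`S⁻¹S = 1`, `S_F⁻¹S_F = 1`, `hK_lattice`, `S_FS_F⁻¹ = 1`);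
* `G1ofU_laplaceAofU` — `G₁(Δ_af) = f` (finite dimension: the right inverse is a left inverse, `greenK_apply`);
* **`norm_conjX1_sub_X1_le`** — `‖(S_FQS⁻¹)(SG₁S⁻¹)(SQ†S_F⁻¹)g − QG₁Q†g‖ ≤ s₁‖g‖` with `B9Eq3126ConjugatedQG1QLetters`' `s₁` at `C_Q`, `C_P`, `ρ`, `β`, `β_K`;
* **`norm_conjKinv_le`** — `‖(S_F∘(QG₁Q*)⁻¹∘S_F⁻¹)v‖ ≤ (2∕μ₁)‖v‖` on the circle, in the windows.
HONEST SCOPE.  Every `U` (unit-ball bond variables), `χ`, `κ` of the letters; NO `η`, NO volume in the constants; `γ`, `μ₁`, `p_K`, `β_K`, `C_Q`, the `Q(U)`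
seams, `ρ`, `C_P` DISPLAYED (suppliers for `ρ`, `C_P`: `B9Eq349ConjugatedProjectionDifferenceChain`, `B9Eq325ProjectionDivergenceQuarterKappa`; for the
`Q(U)` seams: none in the tree — road B8″'s ∕ the OWNER's first refusal); no block decay concluded here (the read-out on `F` needs a point family and
multipliers on `F` — next file); NOT NE9 (cell pub-balaban: NE9 NOT PRINTED ∕ NOT PROVED; «NE9 ⇐ the named binders»; row WALLED ON A MODEL (O-NE9-1;
#5 UNRULED); spine PROVED 0∕9; rung (B)+1 on a finite T⁴ — NOT infinite volume, NOT mass gap, NOT BetaPertH, NOT Clay; HONEST DEPENDENCY: continuum YM on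
T⁴ ⇐ BetaPertH ∧ nine spine estimates (0/9 proved); BetaPertH ⇐ (D1) ∧ (D4) ∧ CAP+tail).  NEW file; nothing modified.  Net new unproved facts: 0.
-/

noncomputable section

open scoped InnerProductSpace ComplexConjugate BigOperators

namespace Literature.MathematicalPhysics.QuantumFieldTheory.Balaban1983to89.B9Eq3126ConjugatedQG1QInv

open B4Sect5Torus (TSite)
open B9SectCLatticeCarrier (Bond bpos btgt)
open B9Eq311L2Pairing (WL2)
open B7Prop1Explicit (U1)
open B9Eq319QprimeTorus (fineP)
open B11Eq103H1Complex (SiteL2K BondL2K greenK apply_greenK greenK_apply covDerivL2K covDivL2K adjoint_covDerivL2K KinvLatticeK hK_lattice)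
open B9Eq310HessianOperator (adTransportW PlaqL2K covCurlL2K covCoCurlL2K curvOp adjoint_covCurlL2K)
open B9Eq3101ConjugationLettersChain (norm_adTransportW_le norm_mulOp_covDerivL2K_adTransportW_sub_le)
open B9Eq3101ConjugationLettersCurl (norm_mulOp_covCurlL2K_sub_le norm_mulOp_covDivL2K_sub_le)
open B9Eq3101ConjugationLettersCoCurl (norm_mulOp_covCoCurlL2K_sub_le)
open B9Eq326OperatorAssembly (laplaceAofU RofU RofU_isSymmetric G1ofU)
open B9Eq326ConjugatedDeltaA (conj_inv_eta' re_inner_RofU_eq norm_RofU_le deltaA_structure conjDeltaA_apply conjDeltaA_conjInv apply_inv_apply'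
  apply_apply_inv')
open B9Eq3126ConjugatedQG1QLetters (norm_X1k_sub_X1_le norm_c1k_le)

section Instance

variable {d : ℕ} (L : ℕ) [NeZero L] (m : Fin d → ℕ) {𝔸 : Type*} [NormedRing 𝔸] [StarRing 𝔸] [NormedAlgebra ℂ 𝔸] [StarModule ℂ 𝔸] [NormOneClass 𝔸]
  {W : Type*} [NormedAddCommGroup W] [InnerProductSpace ℂ W] [FiniteDimensional ℂ W] (φ : W ≃ₗ[ℂ] 𝔸) {Mφ Mφ' : ℝ}
  (hφ : ∀ w, ‖φ w‖ ≤ Mφ * ‖w‖) (hφ' : ∀ X, ‖φ.symm X‖ ≤ Mφ' * ‖X‖) (hMφ : 0 ≤ Mφ) (hMφ' : 0 ≤ Mφ')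
  {c₀ : ℝ} [Fact (0 < c₀)] {η : ℝ} (hη : 0 < η) (U : Bond d (fineP L m) → 𝔸ˣ) (hU : ∀ b, U b ∈ U1 𝔸)
  (hRS : ∀ (b : Bond d (fineP L m)) (v u : W), ⟪adTransportW φ U b v, u⟫_ℂ = ⟪v, adTransportW φ (fun b => (U b)⁻¹) b u⟫_ℂ)
  (τ : 𝔸 →ₗ[ℂ] ℂ) {F : Type*} [NormedAddCommGroup F] [InnerProductSpace ℂ F] [FiniteDimensional ℂ F]
  (Q : BondL2K ℂ d (fineP L m) c₀ W →ₗ[ℂ] F) (a : ℝ)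

variable {κ : ℂ} {χ : TSite d (fineP L m) → ℝ}
  {S Sinv : BondL2K ℂ d (fineP L m) c₀ W →ₗ[ℂ] BondL2K ℂ d (fineP L m) c₀ W}
  (hS : ∀ (g : BondL2K ℂ d (fineP L m) c₀ W) (b : Bond d (fineP L m)),
    WL2.equiv ℂ (fun _ : Bond d (fineP L m) => c₀) W (S g) b =
      Complex.exp (κ * (χ (bpos b) : ℂ)) • WL2.equiv ℂ (fun _ : Bond d (fineP L m) => c₀) W g b)
  (hSinv : ∀ (g : BondL2K ℂ d (fineP L m) c₀ W) (b : Bond d (fineP L m)),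
    WL2.equiv ℂ (fun _ : Bond d (fineP L m) => c₀) W (Sinv g) b =
      Complex.exp (-(κ * (χ (bpos b) : ℂ))) • WL2.equiv ℂ (fun _ : Bond d (fineP L m) => c₀) W g b)
  {SP SPinv : PlaqL2K ℂ d (fineP L m) c₀ W →ₗ[ℂ] PlaqL2K ℂ d (fineP L m) c₀ W}
  (hSP : ∀ (g : PlaqL2K ℂ d (fineP L m) c₀ W) (p : B9SectCLatticeCarrier.Plaq d (fineP L m)),
    WL2.equiv ℂ (fun _ : B9SectCLatticeCarrier.Plaq d (fineP L m) => c₀) W (SP g) p =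
      Complex.exp (κ * (χ p.1 : ℂ)) • WL2.equiv ℂ (fun _ : B9SectCLatticeCarrier.Plaq d (fineP L m) => c₀) W g p)
  (hSPinv : ∀ (g : PlaqL2K ℂ d (fineP L m) c₀ W) (p : B9SectCLatticeCarrier.Plaq d (fineP L m)),
    WL2.equiv ℂ (fun _ : B9SectCLatticeCarrier.Plaq d (fineP L m) => c₀) W (SPinv g) p =
      Complex.exp (-(κ * (χ p.1 : ℂ))) • WL2.equiv ℂ (fun _ : B9SectCLatticeCarrier.Plaq d (fineP L m) => c₀) W g p)
  {SS SSinv : SiteL2K ℂ d (fineP L m) c₀ W →ₗ[ℂ] SiteL2K ℂ d (fineP L m) c₀ W}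
  (hSS : ∀ (g : SiteL2K ℂ d (fineP L m) c₀ W) (x : TSite d (fineP L m)),
    WL2.equiv ℂ (fun _ : TSite d (fineP L m) => c₀) W (SS g) x =
      Complex.exp (κ * (χ x : ℂ)) • WL2.equiv ℂ (fun _ : TSite d (fineP L m) => c₀) W g x)
  (hSSinv : ∀ (g : SiteL2K ℂ d (fineP L m) c₀ W) (x : TSite d (fineP L m)),
    WL2.equiv ℂ (fun _ : TSite d (fineP L m) => c₀) W (SSinv g) x =
      Complex.exp (-(κ * (χ x : ℂ))) • WL2.equiv ℂ (fun _ : TSite d (fineP L m) => c₀) W g x)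
  {SF SFinv : F →ₗ[ℂ] F} (hSFi : ∀ g, SFinv (SF g) = g) (hSFs : ∀ g, SF (SFinv g) = g)

/-! ## §0 Algebra: the factorisation of the conjugated `Q†aQ`, the conjugated right inverse, the left inverse -/

omit [NeZero L] [StarRing 𝔸] [StarModule ℂ 𝔸] [NormOneClass 𝔸] in
include hSFi in
/-- **`S(Q†(a•Q(S⁻¹f))) = a•(S∘Q†∘S_F⁻¹)((S_F∘Q∘S⁻¹)f)`** — the factorisation `hQfac` of `B9Eq326ConjugatedDeltaA.conjDeltaA_apply` for the pair
`Q_κ = S_FQS⁻¹`, `Q′_κ = SQ†S_F⁻¹`. [folklore] [cite: Balaban1985BackgroundPropagators, (3.26) p.395, (3.49) p.399] -/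
theorem X1_factorisation (S Sinv : BondL2K ℂ d (fineP L m) c₀ W →ₗ[ℂ] BondL2K ℂ d (fineP L m) c₀ W) (f : BondL2K ℂ d (fineP L m) c₀ W) :
    S (LinearMap.adjoint Q (((a : ℝ) : ℂ) • Q (Sinv f))) =
      ((a : ℝ) : ℂ) • (S ∘ₗ LinearMap.adjoint Q ∘ₗ SFinv) ((SF ∘ₗ Q ∘ₗ Sinv) f) := by
  simp only [LinearMap.comp_apply, map_smul, hSFi]

omit [NormOneClass 𝔸] in
include hS hSinv hSFi hSFs in
/-- **THE CONJUGATE OF `(QG₁Q*)⁻¹` IS A RIGHT INVERSE OF THE CONJUGATED GRAM OPERATOR**: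
`(S_FQS⁻¹)((SG₁S⁻¹)((SQ†S_F⁻¹)((S_F(QG₁Q*)⁻¹S_F⁻¹)v))) = v` — `S⁻¹S = 1` twice, `S_F⁻¹S_F = 1`, [B11] (45)'s `QG₁Q*(QG₁Q*)⁻¹ = 1` (`hK_lattice`, PROVED in the
tree), `S_FS_F⁻¹ = 1`. [cite: Balaban1985Variational, (45) p.285, (110) p.294; Balaban1985BackgroundPropagators, (3.49) p.399] -/
theorem conjKinv_rightInverse
    (hpos : ∀ x : BondL2K ℂ d (fineP L m) c₀ W, x ≠ 0 → 0 < RCLike.re ⟪x, laplaceAofU L m φ η U τ Q a x⟫_ℂ) (hQs : Function.Surjective Q) (v : F) :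
    (SF ∘ₗ Q ∘ₗ Sinv) ((S ∘ₗ G1ofU L m φ η U τ hpos ∘ₗ Sinv) ((S ∘ₗ LinearMap.adjoint Q ∘ₗ SFinv) ((SF ∘ₗ KinvLatticeK hpos hQs ∘ₗ SFinv) v))) = v := by
  simp only [LinearMap.comp_apply]
  rw [apply_inv_apply' κ (fun b : Bond d (fineP L m) => χ (bpos b)) hS hSinv, apply_inv_apply' κ (fun b : Bond d (fineP L m) => χ (bpos b)) hS hSinv, hSFi]
  unfold G1ofU
  rw [hK_lattice hpos hQs, hSFs]

omit [NormOneClass 𝔸] in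
/-- **`G₁(U)(Δ_a(U)f) = f`** — in finite dimension the right inverse `G₁ = Δ_a⁻¹` is a left inverse (`greenK_apply`).
[cite: Balaban1985Variational, (110) p.294; Balaban1985BackgroundPropagators, Thm 3.11 p.416] -/
theorem G1ofU_laplaceAofU
    (hpos : ∀ x : BondL2K ℂ d (fineP L m) c₀ W, x ≠ 0 → 0 < RCLike.re ⟪x, laplaceAofU L m φ η U τ Q a x⟫_ℂ) (f : BondL2K ℂ d (fineP L m) c₀ W) :
    G1ofU L m φ η U τ hpos (laplaceAofU L m φ η U τ Q a f) = f := by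
  unfold G1ofU B11Eq103H1Complex.G1LatticeK B11Eq103H1Complex.G1K laplaceAofU B11Eq103H1Complex.laplaceALatticeK
  rw [greenK_apply]

omit [NormOneClass 𝔸] in
/-- **`Δ_a(U)(G₁(U)v) = v`** (`apply_greenK`). [cite: Balaban1985Variational, (110) p.294] -/
theorem laplaceAofU_G1ofU
    (hpos : ∀ x : BondL2K ℂ d (fineP L m) c₀ W, x ≠ 0 → 0 < RCLike.re ⟪x, laplaceAofU L m φ η U τ Q a x⟫_ℂ) (v : BondL2K ℂ d (fineP L m) c₀ W) :
    laplaceAofU L m φ η U τ Q a (G1ofU L m φ η U τ hpos v) = v := by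
  unfold G1ofU B11Eq103H1Complex.G1LatticeK B11Eq103H1Complex.G1K laplaceAofU B11Eq103H1Complex.laplaceALatticeK
  rw [apply_greenK]

omit [NormOneClass 𝔸] in
include hS hSinv in
/-- **`(SG₁S⁻¹)((SΔ_aS⁻¹)s) = s`** (`S⁻¹S = 1`, `G₁Δ_a = 1`, `SS⁻¹ = 1`). [cite: Balaban1985Variational, (110) p.294; Balaban1985BackgroundPropagators, (3.49) p.399] -/
theorem conjInv_conjDeltaA
    (hpos : ∀ x : BondL2K ℂ d (fineP L m) c₀ W, x ≠ 0 → 0 < RCLike.re ⟪x, laplaceAofU L m φ η U τ Q a x⟫_ℂ) (s : BondL2K ℂ d (fineP L m) c₀ W) :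
    (S ∘ₗ G1ofU L m φ η U τ hpos ∘ₗ Sinv) ((S ∘ₗ laplaceAofU L m φ η U τ Q a ∘ₗ Sinv) s) = s := by
  simp only [LinearMap.comp_apply]
  rw [apply_inv_apply' κ (fun b : Bond d (fineP L m) => χ (bpos b)) hS hSinv, G1ofU_laplaceAofU,
    apply_apply_inv' κ (fun b : Bond d (fineP L m) => χ (bpos b)) hS hSinv]

/-! ## §1 The four discharged first-order letters (as in `B9Eq326ConjugatedDeltaA.norm_conjG1ofU_le`) -/

omit [NeZero L] [StarRing 𝔸] [StarModule ℂ 𝔸] in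
include hφ hφ' hMφ hMφ' hη hU hRS hS hSinv hSP hSPinv hSS hSSinv in
/-- The curl ∕ cocurl ∕ divergence ∕ gradient conjugation letters in the windows `‖κ‖ℓη ≤ 1`, `4‖κ‖ℓM_φM_φ′d√d ≤ β`, `4‖κ‖ℓM_φM_φ′d ≤ β`, `2‖κ‖ℓM_φM_φ′√d ≤ β`:
`‖S_PB₁S⁻¹ − B₁‖`, `‖SB₁†S_P⁻¹ − B₁†‖`, `‖S_SB₂S⁻¹ − B₂‖`, `‖SB₂†S_S⁻¹ − B₂†‖ ≤ β` (`B9Eq3101ConjugationLettersCurl` ∕ `…CoCurl` ∕ `…Chain`).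
[cite: Balaban1985BackgroundPropagators, (3.3)–(3.8) p.391, (3.49) p.399] -/
theorem conj_letters {β ℓ : ℝ} (hℓ : 0 ≤ ℓ)
    (hχ : ∀ b : Bond d (fineP L m), |χ (bpos b) - χ (btgt b)| ≤ ℓ * η) (hwin : ‖κ‖ * ℓ * η ≤ 1)
    (hβCC : 4 * ‖κ‖ * ℓ * (Mφ * Mφ') * (d * Real.sqrt d) ≤ β) (hβC : 4 * ‖κ‖ * ℓ * (Mφ * Mφ') * d ≤ β)
    (hβD : 2 * ‖κ‖ * ℓ * (Mφ * Mφ') * Real.sqrt d ≤ β) :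
    (∀ f, ‖(SP ∘ₗ covCurlL2K ℂ c₀ ((η : ℂ))⁻¹ (adTransportW φ U) ∘ₗ Sinv) f - covCurlL2K ℂ c₀ ((η : ℂ))⁻¹ (adTransportW φ U) f‖ ≤ β * ‖f‖) ∧
    (∀ p, ‖(S ∘ₗ covCoCurlL2K ℂ c₀ ((η : ℂ))⁻¹ (adTransportW φ fun b => (U b)⁻¹) ∘ₗ SPinv) p -
      LinearMap.adjoint (covCurlL2K ℂ c₀ ((η : ℂ))⁻¹ (adTransportW φ U)) p‖ ≤ β * ‖p‖) ∧
    (∀ f, ‖(SS ∘ₗ covDivL2K ℂ c₀ ((η : ℂ))⁻¹ (adTransportW φ fun b => (U b)⁻¹) ∘ₗ Sinv) f -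
      covDivL2K ℂ c₀ ((η : ℂ))⁻¹ (adTransportW φ fun b => (U b)⁻¹) f‖ ≤ β * ‖f‖) ∧
    (∀ s, ‖(S ∘ₗ covDerivL2K ℂ c₀ ((η : ℂ))⁻¹ (adTransportW φ U) ∘ₗ SSinv) s -
      LinearMap.adjoint (covDivL2K ℂ c₀ ((η : ℂ))⁻¹ (adTransportW φ fun b => (U b)⁻¹)) s‖ ≤ β * ‖s‖) := by
  have hR : ∀ (b : Bond d (fineP L m)) (w : W), ‖adTransportW φ U b w‖ ≤ Mφ * Mφ' * ‖w‖ :=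
    fun b w => norm_adTransportW_le φ hφ hφ' hMφ' U b (hU b) w
  have hSad : ∀ (b : Bond d (fineP L m)) (w : W), ‖adTransportW φ (fun b => (U b)⁻¹) b w‖ ≤ Mφ * Mφ' * ‖w‖ :=
    fun b w => norm_adTransportW_le φ hφ hφ' hMφ' (fun b => (U b)⁻¹) b ((U1 𝔸).inv_mem (hU b)) w
  have hMT : 0 ≤ Mφ * Mφ' := mul_nonneg hMφ hMφ'
  have hθ : 0 ≤ ℓ * η := mul_nonneg hℓ hη.le
  have hwin' : ‖κ‖ * (ℓ * η) ≤ 1 := by simpa [mul_assoc] using hwin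
  have hcθ : ‖((η : ℂ))⁻¹‖ * (ℓ * η) = ℓ := by
    rw [norm_inv, Complex.norm_real, Real.norm_eq_abs, abs_of_pos hη]; field_simp
  have h1 : LinearMap.adjoint (covCurlL2K ℂ c₀ ((η : ℂ))⁻¹ (adTransportW φ U)) =
      covCoCurlL2K ℂ c₀ ((η : ℂ))⁻¹ (adTransportW φ fun b => (U b)⁻¹) := adjoint_covCurlL2K _ (conj_inv_eta' η) _ _ hRS
  have h2 : LinearMap.adjoint (covDivL2K ℂ c₀ ((η : ℂ))⁻¹ (adTransportW φ fun b => (U b)⁻¹)) =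
      covDerivL2K ℂ c₀ ((η : ℂ))⁻¹ (adTransportW φ U) := by
    rw [← adjoint_covDerivL2K ((η : ℂ))⁻¹ (conj_inv_eta' η) _ _ hRS, LinearMap.adjoint_adjoint]
  refine ⟨fun f => ?_, fun p => ?_, fun f => ?_, fun s => ?_⟩
  · have h := norm_mulOp_covCurlL2K_sub_le hθ hMT hR hχ hwin' ((η : ℂ))⁻¹ SP hSP Sinv hSinv f
    simp only [LinearMap.comp_apply]
    refine h.trans ?_
    calc 4 * ‖((η : ℂ))⁻¹‖ * ‖κ‖ * (ℓ * η) * (Mφ * Mφ') * d * ‖f‖ = 4 * ‖κ‖ * ℓ * (Mφ * Mφ') * d * ‖f‖ := by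
          rw [show 4 * ‖((η : ℂ))⁻¹‖ * ‖κ‖ * (ℓ * η) = 4 * ‖κ‖ * (‖((η : ℂ))⁻¹‖ * (ℓ * η)) by ring, hcθ]
      _ ≤ β * ‖f‖ := mul_le_mul_of_nonneg_right hβC (norm_nonneg _)
  · rw [h1]
    have h := norm_mulOp_covCoCurlL2K_sub_le hθ hMT hSad hχ hwin' ((η : ℂ))⁻¹ S hS SPinv hSPinv p
    simp only [LinearMap.comp_apply]
    refine h.trans ?_
    calc 4 * ‖((η : ℂ))⁻¹‖ * ‖κ‖ * (ℓ * η) * (Mφ * Mφ') * (d * Real.sqrt d) * ‖p‖ = 4 * ‖κ‖ * ℓ * (Mφ * Mφ') * (d * Real.sqrt d) * ‖p‖ := by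
          rw [show 4 * ‖((η : ℂ))⁻¹‖ * ‖κ‖ * (ℓ * η) = 4 * ‖κ‖ * (‖((η : ℂ))⁻¹‖ * (ℓ * η)) by ring, hcθ]
      _ ≤ β * ‖p‖ := mul_le_mul_of_nonneg_right hβCC (norm_nonneg _)
  · have h := norm_mulOp_covDivL2K_sub_le hθ hMT hSad hχ hwin' ((η : ℂ))⁻¹ SS hSS Sinv hSinv f
    simp only [LinearMap.comp_apply]
    refine h.trans ?_
    calc 2 * ‖((η : ℂ))⁻¹‖ * ‖κ‖ * (ℓ * η) * (Mφ * Mφ') * Real.sqrt d * ‖f‖ = 2 * ‖κ‖ * ℓ * (Mφ * Mφ') * Real.sqrt d * ‖f‖ := by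
          rw [show 2 * ‖((η : ℂ))⁻¹‖ * ‖κ‖ * (ℓ * η) = 2 * ‖κ‖ * (‖((η : ℂ))⁻¹‖ * (ℓ * η)) by ring, hcθ]
      _ ≤ β * ‖f‖ := mul_le_mul_of_nonneg_right hβD (norm_nonneg _)
  · rw [h2]
    have h := norm_mulOp_covDerivL2K_adTransportW_sub_le φ hφ hφ' hMφ hMφ' hη hℓ U hU hχ hwin S hS SSinv hSSinv s
    simp only [LinearMap.comp_apply]
    exact h.trans (mul_le_mul_of_nonneg_right hβD (norm_nonneg _))

/-! ## §2 The seam of the second Gram operator and the bound of the conjugated `(QG₁Q*)⁻¹` -/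

include hφ hφ' hMφ hMφ' hη hU hRS hS hSinv hSP hSPinv hSS hSSinv hSFi in
/-- **THE CONJUGATED SECOND GRAM OPERATOR AGAINST `QG₁Q†`**: `‖(S_FQS⁻¹)((SG₁S⁻¹)((SQ†S_F⁻¹)g)) − Q(G₁(Q†g))‖ ≤ s₁‖g‖` —
`B9Eq3126ConjugatedQG1QLetters.norm_X1k_sub_X1_le` at the chain, curl ∕ div ∕ grad letters discharged, both inverse identities proved, the rest displayed.
[folklore] [cite: Balaban1985BackgroundPropagators, (3.126) p.420, (3.49) p.399, (3.26) p.395, Thm 3.11 p.416; Balaban1985Variational, (45) p.285, (110) p.294] -/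
theorem norm_conjX1_sub_X1_le (ha : 0 ≤ a)
    (hpos : ∀ x : BondL2K ℂ d (fineP L m) c₀ W, x ≠ 0 → 0 < RCLike.re ⟪x, laplaceAofU L m φ η U τ Q a x⟫_ℂ)
    {γ β βK pK ℓ ρ CP CQ : ℝ} (hγ : 0 < γ) (hγ1 : γ ≤ 1) (hβ : 0 ≤ β) (hβ1 : β ≤ 1) (hβK : 0 ≤ βK) (hℓ : 0 ≤ ℓ) (hρ : 0 ≤ ρ) (hρ8 : ρ ≤ 1 / 8)
    (hCP : 0 ≤ CP) (hCQ : 0 ≤ CQ)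
    (hcoer : ∀ f : BondL2K ℂ d (fineP L m) c₀ W, γ * ‖f‖ ^ 2 ≤ RCLike.re ⟪f, laplaceAofU L m φ η U τ Q a f⟫_ℂ)
    (hKre : ∀ f : BondL2K ℂ d (fineP L m) c₀ W, -(pK * ‖f‖ ^ 2) ≤ RCLike.re ⟪f, curvOp φ τ η U f⟫_ℂ)
    (hQ : ∀ f, ‖Q f‖ ≤ CQ * ‖f‖)
    (hχ : ∀ b : Bond d (fineP L m), |χ (bpos b) - χ (btgt b)| ≤ ℓ * η) (hwin : ‖κ‖ * ℓ * η ≤ 1)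
    (hβCC : 4 * ‖κ‖ * ℓ * (Mφ * Mφ') * (d * Real.sqrt d) ≤ β) (hβC : 4 * ‖κ‖ * ℓ * (Mφ * Mφ') * d ≤ β)
    (hβD : 2 * ‖κ‖ * ℓ * (Mφ * Mφ') * Real.sqrt d ≤ β)
    (dQ : ∀ f, ‖(SF ∘ₗ Q ∘ₗ Sinv) f - Q f‖ ≤ β * ‖f‖) (dQ' : ∀ g, ‖(S ∘ₗ LinearMap.adjoint Q ∘ₗ SFinv) g - LinearMap.adjoint Q g‖ ≤ β * ‖g‖)
    (dK : ∀ f, ‖(S ∘ₗ curvOp φ τ η U ∘ₗ Sinv) f - curvOp φ τ η U f‖ ≤ βK * ‖f‖)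
    (dR : ∀ s, ‖(SS ∘ₗ RofU L m φ η U (c₀ := c₀) ∘ₗ SSinv) s - RofU L m φ η U (c₀ := c₀) s‖ ≤ ρ * ‖s‖)
    (hP : ∀ f, ‖covDivL2K ℂ c₀ ((η : ℂ))⁻¹ (adTransportW φ fun b => (U b)⁻¹) f -
      RofU L m φ η U (c₀ := c₀) (covDivL2K ℂ c₀ ((η : ℂ))⁻¹ (adTransportW φ fun b => (U b)⁻¹) f)‖ ≤ CP * ‖f‖)
    (small : pK / 2 + (21 + 3 * a) * β ^ 2 + 4 * β * CP + 2 * ρ * CP ^ 2 + βK ≤ γ / 4) (g : F) :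
    ‖(SF ∘ₗ Q ∘ₗ Sinv) ((S ∘ₗ G1ofU L m φ η U τ hpos ∘ₗ Sinv) ((S ∘ₗ LinearMap.adjoint Q ∘ₗ SFinv) g)) -
        Q (G1ofU L m φ η U τ hpos (LinearMap.adjoint Q g))‖ ≤
      (β * (4 / γ) * (2 * CQ + 1) + CQ * (CQ + 1) *
        (β * (4 / γ * (2 * (8 / γ) + (8 / γ + 4 / γ) + 2 * ((8 / γ + 4 / γ * CP) + 4 / γ) + a * CQ * (4 / γ) + a * (CQ + 1) * (4 / γ))) +
          ρ * ((8 / γ + 4 / γ * CP) * ((8 / γ + 4 / γ * CP) + 4 / γ)) + βK * (4 / γ) ^ 2)) * ‖g‖ := by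
  obtain ⟨dB₁, dB₁', dB₂, dB₂'⟩ := conj_letters L m φ hφ hφ' hMφ hMφ' hη U hU hRS (κ := κ) (χ := χ) hS hSinv hSP hSPinv hSS hSSinv hℓ hχ hwin hβCC hβC hβD
  have hRsq := re_inner_RofU_eq L m φ (η := η) (c₀ := c₀) U
  have hR1 := norm_RofU_le L m φ (η := η) (c₀ := c₀) U
  have hRsa : ∀ x y, ⟪RofU L m φ η U (c₀ := c₀) x, y⟫_ℂ = ⟪x, RofU L m φ η U (c₀ := c₀) y⟫_ℂ := fun x y => RofU_isSymmetric L m φ η U (c₀ := c₀) x y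
  have hH := deltaA_structure L m φ (η := η) U hRS τ Q a
  have hHk := conjDeltaA_apply L m φ (η := η) U hRS τ Q a (κ := κ) (χ := χ) (S := S) (Sinv := Sinv) hSP hSPinv hSS hSSinv
    (SF ∘ₗ Q ∘ₗ Sinv) (S ∘ₗ LinearMap.adjoint Q ∘ₗ SFinv) (X1_factorisation L m Q a hSFi S Sinv)
  have hHG := laplaceAofU_G1ofU L m φ U τ Q a hpos
  have hHkGk := conjDeltaA_conjInv L m φ U τ Q a (κ := κ) (χ := χ) hS hSinv hpos
  have hGkHk := conjInv_conjDeltaA L m φ U τ Q a (κ := κ) (χ := χ) hS hSinv hpos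
  exact norm_X1k_sub_X1_le (covCurlL2K ℂ c₀ ((η : ℂ))⁻¹ (adTransportW φ U)) (covDivL2K ℂ c₀ ((η : ℂ))⁻¹ (adTransportW φ fun b => (U b)⁻¹))
    (RofU L m φ η U (c₀ := c₀)) Q (curvOp φ τ η U) (laplaceAofU L m φ η U τ Q a) (G1ofU L m φ η U τ hpos) a γ β βK pK ρ CP CQ _ _ _ _
    (SS ∘ₗ RofU L m φ η U (c₀ := c₀) ∘ₗ SSinv) (SF ∘ₗ Q ∘ₗ Sinv) (S ∘ₗ LinearMap.adjoint Q ∘ₗ SFinv) (S ∘ₗ curvOp φ τ η U ∘ₗ Sinv)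
    (S ∘ₗ laplaceAofU L m φ η U τ Q a ∘ₗ Sinv) (S ∘ₗ G1ofU L m φ η U τ hpos ∘ₗ Sinv)
    ha hγ hγ1 hβ hβ1 hβK hρ hρ8 hCP hCQ hRsq hR1 hRsa hH hcoer hKre hP hQ dB₁ dB₁' dB₂ dB₂' dR dQ dQ' dK small hHk hHG hHkGk hGkHk g

include hφ hφ' hMφ hMφ' hη hU hRS hS hSinv hSP hSPinv hSS hSSinv hSFi hSFs in
/-- **THE CONJUGATED INVERSE GRAM OPERATOR IS BOUNDED BY `2∕μ₁`: `‖(S_F∘(QG₁Q*)⁻¹∘S_F⁻¹)v‖ ≤ (2∕μ₁)‖v‖`** —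
`B9Eq3126ConjugatedQG1QLetters.norm_c1k_le` at the chain's `Δ_a(U)`, `G₁(U)`, `(QG₁Q*)⁻¹ = KinvLatticeK` with the right-inverse identity
`conjKinv_rightInverse` PROVED; curl ∕ div ∕ grad letters discharged in the windows; DISPLAYED: `γ` (Thm 3.11), `μ₁` ([B11] (45)'s lower bound of
`QG₁Q†`), `p_K`, `β_K`, `C_Q`, the `Q(U)` seams, `ρ ≤ 1∕8`, `C_P`, and the windows `small`, `small2` — every `U`, `χ`, `κ` of the letters, NO `η`,
NO volume. [folklore] [cite: Balaban1985Variational, (45) p.285, (103) p.293, (110) p.294; Balaban1985BackgroundPropagators, (3.126) p.420, (3.49) p.399,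
Thm 3.11 p.416] -/
theorem norm_conjKinv_le (ha : 0 ≤ a)
    (hpos : ∀ x : BondL2K ℂ d (fineP L m) c₀ W, x ≠ 0 → 0 < RCLike.re ⟪x, laplaceAofU L m φ η U τ Q a x⟫_ℂ) (hQs : Function.Surjective Q)
    {γ β βK pK ℓ ρ CP CQ μ₁ : ℝ} (hγ : 0 < γ) (hγ1 : γ ≤ 1) (hβ : 0 ≤ β) (hβ1 : β ≤ 1) (hβK : 0 ≤ βK) (hℓ : 0 ≤ ℓ) (hρ : 0 ≤ ρ) (hρ8 : ρ ≤ 1 / 8)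
    (hCP : 0 ≤ CP) (hCQ : 0 ≤ CQ) (hμ₁ : 0 < μ₁)
    (hcoer : ∀ f : BondL2K ℂ d (fineP L m) c₀ W, γ * ‖f‖ ^ 2 ≤ RCLike.re ⟪f, laplaceAofU L m φ η U τ Q a f⟫_ℂ)
    (hX1 : ∀ g : F, μ₁ * ‖g‖ ^ 2 ≤ RCLike.re ⟪g, Q (G1ofU L m φ η U τ hpos (LinearMap.adjoint Q g))⟫_ℂ)
    (hKre : ∀ f : BondL2K ℂ d (fineP L m) c₀ W, -(pK * ‖f‖ ^ 2) ≤ RCLike.re ⟪f, curvOp φ τ η U f⟫_ℂ)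
    (hQ : ∀ f, ‖Q f‖ ≤ CQ * ‖f‖)
    (hχ : ∀ b : Bond d (fineP L m), |χ (bpos b) - χ (btgt b)| ≤ ℓ * η) (hwin : ‖κ‖ * ℓ * η ≤ 1)
    (hβCC : 4 * ‖κ‖ * ℓ * (Mφ * Mφ') * (d * Real.sqrt d) ≤ β) (hβC : 4 * ‖κ‖ * ℓ * (Mφ * Mφ') * d ≤ β)
    (hβD : 2 * ‖κ‖ * ℓ * (Mφ * Mφ') * Real.sqrt d ≤ β)
    (dQ : ∀ f, ‖(SF ∘ₗ Q ∘ₗ Sinv) f - Q f‖ ≤ β * ‖f‖) (dQ' : ∀ g, ‖(S ∘ₗ LinearMap.adjoint Q ∘ₗ SFinv) g - LinearMap.adjoint Q g‖ ≤ β * ‖g‖)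
    (dK : ∀ f, ‖(S ∘ₗ curvOp φ τ η U ∘ₗ Sinv) f - curvOp φ τ η U f‖ ≤ βK * ‖f‖)
    (dR : ∀ s, ‖(SS ∘ₗ RofU L m φ η U (c₀ := c₀) ∘ₗ SSinv) s - RofU L m φ η U (c₀ := c₀) s‖ ≤ ρ * ‖s‖)
    (hP : ∀ f, ‖covDivL2K ℂ c₀ ((η : ℂ))⁻¹ (adTransportW φ fun b => (U b)⁻¹) f -
      RofU L m φ η U (c₀ := c₀) (covDivL2K ℂ c₀ ((η : ℂ))⁻¹ (adTransportW φ fun b => (U b)⁻¹) f)‖ ≤ CP * ‖f‖)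
    (small : pK / 2 + (21 + 3 * a) * β ^ 2 + 4 * β * CP + 2 * ρ * CP ^ 2 + βK ≤ γ / 4)
    (small2 : β * (4 / γ) * (2 * CQ + 1) + CQ * (CQ + 1) *
        (β * (4 / γ * (2 * (8 / γ) + (8 / γ + 4 / γ) + 2 * ((8 / γ + 4 / γ * CP) + 4 / γ) + a * CQ * (4 / γ) + a * (CQ + 1) * (4 / γ))) +
          ρ * ((8 / γ + 4 / γ * CP) * ((8 / γ + 4 / γ * CP) + 4 / γ)) + βK * (4 / γ) ^ 2) ≤ μ₁ / 2) (v : F) :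
    ‖(SF ∘ₗ KinvLatticeK hpos hQs ∘ₗ SFinv) v‖ ≤ 2 / μ₁ * ‖v‖ := by
  obtain ⟨dB₁, dB₁', dB₂, dB₂'⟩ := conj_letters L m φ hφ hφ' hMφ hMφ' hη U hU hRS (κ := κ) (χ := χ) hS hSinv hSP hSPinv hSS hSSinv hℓ hχ hwin hβCC hβC hβD
  have hRsq := re_inner_RofU_eq L m φ (η := η) (c₀ := c₀) U
  have hR1 := norm_RofU_le L m φ (η := η) (c₀ := c₀) U
  have hRsa : ∀ x y, ⟪RofU L m φ η U (c₀ := c₀) x, y⟫_ℂ = ⟪x, RofU L m φ η U (c₀ := c₀) y⟫_ℂ := fun x y => RofU_isSymmetric L m φ η U (c₀ := c₀) x y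
  have hH := deltaA_structure L m φ (η := η) U hRS τ Q a
  have hHk := conjDeltaA_apply L m φ (η := η) U hRS τ Q a (κ := κ) (χ := χ) (S := S) (Sinv := Sinv) hSP hSPinv hSS hSSinv
    (SF ∘ₗ Q ∘ₗ Sinv) (S ∘ₗ LinearMap.adjoint Q ∘ₗ SFinv) (X1_factorisation L m Q a hSFi S Sinv)
  have hHG := laplaceAofU_G1ofU L m φ U τ Q a hpos
  have hHkGk := conjDeltaA_conjInv L m φ U τ Q a (κ := κ) (χ := χ) hS hSinv hpos
  have hGkHk := conjInv_conjDeltaA L m φ U τ Q a (κ := κ) (χ := χ) hS hSinv hpos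
  have hck := conjKinv_rightInverse L m φ U τ Q a (κ := κ) (χ := χ) hS hSinv hSFi hSFs hpos hQs
  exact norm_c1k_le (covCurlL2K ℂ c₀ ((η : ℂ))⁻¹ (adTransportW φ U)) (covDivL2K ℂ c₀ ((η : ℂ))⁻¹ (adTransportW φ fun b => (U b)⁻¹))
    (RofU L m φ η U (c₀ := c₀)) Q (curvOp φ τ η U) (laplaceAofU L m φ η U τ Q a) (G1ofU L m φ η U τ hpos) a γ β βK pK ρ CP CQ _ _ _ _
    (SS ∘ₗ RofU L m φ η U (c₀ := c₀) ∘ₗ SSinv) (SF ∘ₗ Q ∘ₗ Sinv) (S ∘ₗ LinearMap.adjoint Q ∘ₗ SFinv) (S ∘ₗ curvOp φ τ η U ∘ₗ Sinv)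
    (S ∘ₗ laplaceAofU L m φ η U τ Q a ∘ₗ Sinv) (S ∘ₗ G1ofU L m φ η U τ hpos ∘ₗ Sinv)
    ha hγ hγ1 hβ hβ1 hβK hρ hρ8 hCP hCQ hRsq hR1 hRsa hH hcoer hKre hP hQ dB₁ dB₁' dB₂ dB₂' dR dQ dQ' dK small hHk hHG hHkGk hGkHk
    hμ₁ hX1 (SF ∘ₗ KinvLatticeK hpos hQs ∘ₗ SFinv) hck small2 v

end Instance

end Literature.MathematicalPhysics.QuantumFieldTheory.Balaban1983to89.B9Eq3126ConjugatedQG1QInv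

end
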